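import Literature.Analysis.FluidPDE.OseenDuhamelFar
import Mathlib.Analysis.Calculus.ContDiff.Bounds
import HarnessLib

/-!
# The near part of the Oseen Duhamel term: smooth fields carry the derivatives

Analysis/FluidPDE support file (everything proved, no definitions) on the discharge path of the
named fact `Literature.Analysis.FluidPDE.WeightedBilinearEstimate`
(`NSBoundedMildWeightedPicard.lean`; Koch–Nadirashvili–Seregin–Šverák, Acta Math. 203 (2009) =
arXiv:0709.3599, §4 p. 8: "The key is an estimate of `B` with the same form as (4.4) but in
spaces with norms given by the expression on the left-hand side of (4.5)"). After the smooth time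
cutoff of `OseenDuhamelCutoff.lean` and the substitution `(τ, y) = p - q`, `q = (s, z)`, the near
part of the Duhamel term `B^1_0(v, w)(p)`, `p = (θ, ξ)`, is the **kernel average of translates of
smooth fields**

  `N(p) = ∫_{(0,b) × E} K(s, z)[F(p - q), G(p - q)] dq`,

`K(s, z) = oseenKernel s z` the kernel of `e^{sΔ}P∇·` (`KochTataru.lean`), `F`, `G` the cut-off
fields, jointly `C^∞` on the half-space `{τ < T'}` with bounded derivatives. Here the kernel keeps
its (integrable, `∫_{(0,b)×E} ‖K‖ ≤ C · 2√b`) singularity at `s = 0` and **all space-time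
derivatives in `p` fall on the fields** (KNSS 2009, Prop. 4.1: the part of the estimate of `B` in
the weighted norms (4.5) where `τ` is comparable to `t`). Differentiating under the integral sign
(`FunctionSpaces.contDiffOn_integral_of_dominated`):

* `iteratedFDeriv_section_left_of_isOpen`, `continuousOn_iteratedFDeriv_section_left`: partial
  iterated derivatives of a function smooth on an open subset of a product are the total ones
  composed with the injection `inl`, hence continuous (the measurability of the parameter
  derivatives of the integrand);
* `exists_integral_norm_oseenKernelCLM_slab_le`: `∫_{(0,b)×E} ‖K(s,z)‖ d(s,z) ≤ C · 2√b`
  (Koch–Tataru's bound (14) and `∫ (s + ‖z‖²)^{-(d+1)/2} dz = c s^{-1/2}`; KNSS (4.4));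
* `norm_iteratedFDeriv_oseenKernel_convIntegrand_le`: the Leibniz bound
  `‖D^m_p K(q)[F(p-q), G(p-q)]‖ ≤ ‖K(q)‖ Σᵢ (m choose i) ‖DⁱF(p-q)‖ ‖D^{m-i}G(p-q)‖`;
* `contDiffOn_oseenKernel_conv`: `N` is `C^∞` on `{θ < b} × E` (`b ≤ T'`);
* `norm_iteratedFDeriv_oseenKernel_conv_le`: if the derivatives of orders `≤ m` of `F`, `G` are
  bounded by `C_F`, `C_G` below the height `θ`, then `‖D^m N(θ, ξ)‖ ≤ 2^m C_F C_G · C · 2√b`.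

## References

* G. Koch, N. Nadirashvili, G. Seregin, V. Šverák, *Liouville theorems for the Navier–Stokes
  equations and applications*, Acta Math. 203 (2009) = arXiv:0709.3599, §4 p. 8: (4.3)–(4.5),
  Prop. 4.1. [KochNadirashviliSereginSverak2009]
* H. Koch, D. Tataru, Adv. Math. 157 (2001), §3 (14). [KochTataruAdvMath2001]
-/

noncomputable section

open MeasureTheory Set Function Filter Metric Real
open _root_.Topology
open scoped RealInnerProductSpace ContDiff ENNReal

namespace Literature.Analysis.FluidPDE

/-! ### Partial iterated derivatives of functions smooth on an open subset of a product -/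

section Section

variable {P : Type*} [NormedAddCommGroup P] [NormedSpace ℝ P]
  {Q : Type*} [NormedAddCommGroup Q] [NormedSpace ℝ Q]
  {G : Type*} [NormedAddCommGroup G] [NormedSpace ℝ G]

/-- **Partial iterated derivatives through total ones, on an open set**: if `H` is `C^∞` on the
open set `W ⊆ P × Q` and `(p, q) ∈ W`, then
`D^m [r ↦ H(r, q)](p) = D^m H(p, q) ∘ (inl, …, inl)` (the local version of
`FunctionSpaces.iteratedFDeriv_section_left`). [folklore] -/
theorem iteratedFDeriv_section_left_of_isOpen {H : P × Q → G} {W : Set (P × Q)} (hW : IsOpen W)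
    (hH : ContDiffOn ℝ ∞ H W) (m : ℕ) {p : P} {q : Q} (hpq : (p, q) ∈ W) :
    iteratedFDeriv ℝ m (fun r : P => H (r, q)) p =
      (iteratedFDeriv ℝ m H (p, q)).compContinuousLinearMap fun _ => ContinuousLinearMap.inl ℝ P Q := by
  set c : P × Q := ((0 : P), q) with hc
  set H' : P × Q → G := fun x => H (x + c) with hH'
  set W' : Set (P × Q) := (fun x : P × Q => x + c) ⁻¹' W with hW'
  have hW'o : IsOpen W' := hW.preimage (continuous_id.add continuous_const)
  have hH's : ContDiffOn ℝ ∞ H' W' := hH.comp (contDiffOn_id.add contDiffOn_const) fun x hx => hx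
  set ι : P →L[ℝ] P × Q := ContinuousLinearMap.inl ℝ P Q with hι
  have hιc : ∀ r : P, ι r + c = (r, q) := fun r => by simp [hι, hc]
  have hfun : (fun r : P => H (r, q)) = H' ∘ ι := by
    funext r
    simp only [hH', comp_apply, hιc]
  have hx : ι p ∈ W' := by
    show ι p + c ∈ W
    rw [hιc]; exact hpq
  have hpre : IsOpen (ι ⁻¹' W') := hW'o.preimage ι.continuous
  have key := ι.iteratedFDerivWithin_comp_right hH's hW'o.uniqueDiffOn hpre.uniqueDiffOn hx
    (i := m) (by exact_mod_cast le_top)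
  rw [iteratedFDerivWithin_of_isOpen m hpre (show p ∈ ι ⁻¹' W' from hx),
    iteratedFDerivWithin_of_isOpen m hW'o hx] at key
  rw [hfun, key]
  congr 1
  rw [hH', iteratedFDeriv_comp_add_right, hιc]

/-- **The partial iterated derivatives are continuous** on `W` (jointly in the point and the
parameter): `(p, q) ↦ D^m [r ↦ H(r, q)](p)` is continuous on the open set `W` where `H` is `C^∞`.
[folklore] -/
theorem continuousOn_iteratedFDeriv_section_left {H : P × Q → G} {W : Set (P × Q)} (hW : IsOpen W)
    (hH : ContDiffOn ℝ ∞ H W) (m : ℕ) :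
    ContinuousOn (fun x : P × Q => iteratedFDeriv ℝ m (fun r : P => H (r, x.2)) x.1) W := by
  have hD : ContinuousOn (iteratedFDeriv ℝ m H) W :=
    (hH.continuousOn_iteratedFDerivWithin (m := m) (by exact_mod_cast le_top) hW.uniqueDiffOn).congr
      fun x hx => (iteratedFDerivWithin_of_isOpen m hW hx).symm
  have hL := (ContinuousMultilinearMap.compContinuousLinearMapL (F := G)
    (fun _ : Fin m => ContinuousLinearMap.inl ℝ P Q)).continuous
  refine (hL.comp_continuousOn hD).congr fun x hx => ?_
  rw [comp_apply, ContinuousMultilinearMap.compContinuousLinearMapL_apply]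
  exact iteratedFDeriv_section_left_of_isOpen hW hH m (p := x.1) (q := x.2) hx

end Section

/-! ### The kernel's `L¹` mass on a slab -/

section Kernel

variable {E : Type*} [NormedAddCommGroup E] [InnerProductSpace ℝ E] [FiniteDimensional ℝ E]
  [MeasurableSpace E] [BorelSpace E]

/-- **The parabolic envelope of the kernel is integrable on every slab `(0, b) × E`**: with
`w(s, z) = (s + ‖z‖²)^{-(d+1)/2}` the envelope of Koch–Tataru's bound (14)
(`‖K(s, z)‖ ≤ C w(s, z)`, `exists_norm_oseenKernelCLM_le`), `w` is integrable on `(0, b) × E` and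
`∫_{(0,b)×E} w = I · 2√b`, `I = ∫ (1 + ‖y‖²)^{-(d+1)/2} dy`
(`∫ w(s, ·) = I s^{-1/2}` and `∫₀ᵇ s^{-1/2} ds = 2√b`): the source of the factor `√T` in KNSS's
(4.4), `‖B(u,v)‖ ≤ C√T‖u‖‖v‖`. [cite: KochNadirashviliSereginSverak2009, §4 (4.4) (arXiv:0709.3599 p. 8)] -/
theorem exists_integral_oseenEnvelope_slab_le :
    ∃ C : ℝ, 0 < C ∧ ∃ I : ℝ, 0 < I ∧
      (∀ {σ : ℝ}, 0 < σ → ∀ z : E, ‖oseenKernelCLM σ z‖ ≤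
        C * (σ + ‖z‖ ^ 2) ^ (-(((Module.finrank ℝ E : ℝ) + 1) / 2))) ∧
      ∀ {b : ℝ}, 0 < b →
        Integrable (fun q : ℝ × E => (q.1 + ‖q.2‖ ^ 2) ^ (-(((Module.finrank ℝ E : ℝ) + 1) / 2)))
          ((volume : Measure (ℝ × E)).restrict (Ioo 0 b ×ˢ univ)) ∧
        ∫ q in Ioo 0 b ×ˢ univ, (q.1 + ‖q.2‖ ^ 2) ^ (-(((Module.finrank ℝ E : ℝ) + 1) / 2))
          ∂(volume : Measure (ℝ × E)) ≤ I * (2 * Real.sqrt b) := by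
  set d : ℝ := (Module.finrank ℝ E : ℝ) with hd
  obtain ⟨C₀, hC₀, hK⟩ := exists_norm_oseenKernelCLM_le (E := E)
  set I : ℝ := ∫ w : E, (1 + ‖w‖ ^ 2) ^ (-((d + 1) / 2)) with hI
  have he : d < 2 * ((d + 1) / 2) := by linarith
  have hI0 : 0 < I := integral_one_add_norm_sq_rpow_neg_pos he
  have hscal : d / 2 - (d + 1) / 2 = -(1 / 2 : ℝ) := by ring
  refine ⟨C₀, hC₀, I, hI0, fun {σ} hσ z => hK hσ z, fun {b} hb => ?_⟩
  set S : Set (ℝ × E) := Ioo 0 b ×ˢ univ with hS_def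
  have hS : MeasurableSet S := measurableSet_Ioo.prod MeasurableSet.univ
  set w : ℝ × E → ℝ := fun q => (q.1 + ‖q.2‖ ^ 2) ^ (-((d + 1) / 2)) with hw
  have hwm : Measurable w :=
    (measurable_fst.add (measurable_snd.norm.pow_const 2)).pow_const _
  have hw0 : ∀ q ∈ S, 0 ≤ w q := fun q hq => by
    have h1 : 0 < q.1 := (mem_prod.1 hq).1.1
    exact Real.rpow_nonneg (by positivity) _
  have hmeas : AEStronglyMeasurable w ((volume : Measure (ℝ × E)).restrict S) :=
    hwm.aestronglyMeasurable
  -- the slab bound in `ℝ≥0∞`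
  have key : ∫⁻ q in S, ENNReal.ofReal (w q) = ENNReal.ofReal (I * (2 * Real.sqrt b)) := by
    calc ∫⁻ q in S, ENNReal.ofReal (w q)
        = ∫⁻ s in Ioo (0 : ℝ) b, ∫⁻ z : E, ENNReal.ofReal ((s + ‖z‖ ^ 2) ^ (-((d + 1) / 2))) := by
          rw [hS_def, volume_restrict_prod_univ_eq_prod, lintegral_prod _ hwm.ennreal_ofReal.aemeasurable]
      _ = ∫⁻ s in Ioo (0 : ℝ) b, ENNReal.ofReal (s ^ (d / 2 - (d + 1) / 2) * I) :=
          setLIntegral_congr_fun measurableSet_Ioo fun s hs => lintegral_add_norm_sq_rpow_neg he hs.1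
      _ = ∫⁻ s in Ioo (0 : ℝ) b, ENNReal.ofReal I * ENNReal.ofReal (s ^ (-(1 / 2 : ℝ))) := by
          refine setLIntegral_congr_fun measurableSet_Ioo fun s hs => ?_
          rw [hscal, mul_comm, ENNReal.ofReal_mul hI0.le]
      _ = ENNReal.ofReal I * ENNReal.ofReal (2 * Real.sqrt b) := by
          rw [lintegral_const_mul' _ _ ENNReal.ofReal_ne_top, setLIntegral_Ioo_rpow_neg_half hb]
      _ = ENNReal.ofReal (I * (2 * Real.sqrt b)) := by
          rw [← ENNReal.ofReal_mul hI0.le]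
  have hlin : ∫⁻ q in S, ‖w q‖ₑ = ∫⁻ q in S, ENNReal.ofReal (w q) :=
    setLIntegral_congr_fun hS fun q hq => by rw [← ofReal_norm, Real.norm_of_nonneg (hw0 q hq)]
  have hfin : HasFiniteIntegral w ((volume : Measure (ℝ × E)).restrict S) := by
    rw [hasFiniteIntegral_iff_enorm, hlin, key]
    exact ENNReal.ofReal_lt_top
  refine ⟨⟨hmeas, hfin⟩, le_of_eq ?_⟩
  rw [integral_eq_lintegral_of_nonneg_ae ((ae_restrict_mem hS).mono fun q hq => hw0 q hq) hmeas, key,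
    ENNReal.toReal_ofReal (by positivity)]

end Kernel

/-! ### The near integrand `K(q)[F(p - q), G(p - q)]` -/

section Integrand

variable {E : Type*} [NormedAddCommGroup E] [InnerProductSpace ℝ E] [FiniteDimensional ℝ E]
  [MeasurableSpace E] [BorelSpace E]

variable {T' b : ℝ} {F G : ℝ × E → E}

omit [InnerProductSpace ℝ E] [FiniteDimensional ℝ E] [MeasurableSpace E] [BorelSpace E] in
/-- Translates `p - q` of parameters below the height `b` by `q` with `q.1 > 0` stay below the
height `T' ≥ b`. [folklore] -/
theorem sub_mem_Iio_prod_of_mem (hbT : b ≤ T') {p q : ℝ × E} (hp : p ∈ Iio b ×ˢ (univ : Set E))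
    (hq : q ∈ Ioi (0 : ℝ) ×ˢ (univ : Set E)) : p - q ∈ Iio T' ×ˢ (univ : Set E) := by
  refine mk_mem_prod ?_ (mem_univ _)
  have h1 : p.1 < b := (mem_prod.1 hp).1
  have h2 : 0 < q.1 := (mem_prod.1 hq).1
  show p.1 - q.1 < T'
  linarith

/-- **Joint smoothness of the near integrand**: for `F`, `G` jointly `C^∞` below the height `T'`
and `b ≤ T'`, `(p, q) ↦ K(q)[F(p - q), G(p - q)]` is `C^∞` on `({θ < b} × E) × ((0, ∞) × E)`
(the kernel is jointly smooth on the half-space, `contDiffOn_oseenKernelCLM_prod`). [folklore] -/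
theorem contDiffOn_oseenKernel_convIntegrand_prod (hbT : b ≤ T')
    (hF : ContDiffOn ℝ ∞ F (Iio T' ×ˢ univ)) (hG : ContDiffOn ℝ ∞ G (Iio T' ×ˢ univ)) :
    ContDiffOn ℝ ∞ (fun x : (ℝ × E) × (ℝ × E) =>
        oseenKernelCLM x.2.1 x.2.2 (F (x.1 - x.2)) (G (x.1 - x.2)))
      ((Iio b ×ˢ univ) ×ˢ (Ioi 0 ×ˢ univ)) := by
  have hK : ContDiffOn ℝ ∞ (fun x : (ℝ × E) × (ℝ × E) => oseenKernelCLM x.2.1 x.2.2)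
      ((Iio b ×ˢ (univ : Set E)) ×ˢ (Ioi (0 : ℝ) ×ˢ (univ : Set E))) :=
    contDiffOn_oseenKernelCLM_prod.comp (g := fun r : ℝ × E => oseenKernelCLM r.1 r.2)
      (f := fun x : (ℝ × E) × (ℝ × E) => x.2) contDiffOn_snd fun x hx => (mem_prod.1 hx).2
  have hsub : MapsTo (fun x : (ℝ × E) × (ℝ × E) => x.1 - x.2)
      ((Iio b ×ˢ (univ : Set E)) ×ˢ (Ioi (0 : ℝ) ×ˢ (univ : Set E))) (Iio T' ×ˢ univ) := fun x hx =>
    sub_mem_Iio_prod_of_mem hbT (mem_prod.1 hx).1 (mem_prod.1 hx).2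
  have hFc : ContDiffOn ℝ ∞ (fun x : (ℝ × E) × (ℝ × E) => F (x.1 - x.2))
      ((Iio b ×ˢ (univ : Set E)) ×ˢ (Ioi (0 : ℝ) ×ˢ (univ : Set E))) :=
    hF.comp (f := fun x : (ℝ × E) × (ℝ × E) => x.1 - x.2) (contDiffOn_fst.sub contDiffOn_snd) hsub
  have hGc : ContDiffOn ℝ ∞ (fun x : (ℝ × E) × (ℝ × E) => G (x.1 - x.2))
      ((Iio b ×ˢ (univ : Set E)) ×ˢ (Ioi (0 : ℝ) ×ˢ (univ : Set E))) :=
    hG.comp (f := fun x : (ℝ × E) × (ℝ × E) => x.1 - x.2) (contDiffOn_fst.sub contDiffOn_snd) hsub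
  exact (hK.clm_apply hFc).clm_apply hGc

/-- **Smoothness of the near integrand in the parameter**: for every `q` with `q.1 > 0`,
`p ↦ K(q)[F(p - q), G(p - q)]` is `C^∞` on `{θ < b} × E`. [folklore] -/
theorem contDiffOn_oseenKernel_convIntegrand (hbT : b ≤ T')
    (hF : ContDiffOn ℝ ∞ F (Iio T' ×ˢ univ)) (hG : ContDiffOn ℝ ∞ G (Iio T' ×ˢ univ))
    {q : ℝ × E} (hq : q ∈ Ioi (0 : ℝ) ×ˢ (univ : Set E)) :
    ContDiffOn ℝ ∞ (fun p : ℝ × E => oseenKernelCLM q.1 q.2 (F (p - q)) (G (p - q)))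
      (Iio b ×ˢ univ) := by
  have h := (contDiffOn_oseenKernel_convIntegrand_prod hbT hF hG).comp
    (f := fun p : ℝ × E => (p, q)) (contDiffOn_id.prodMk contDiffOn_const)
    fun _ hp => mk_mem_prod hp hq
  exact h

/-- **Measurability of the parameter derivatives of the near integrand**: for `p` below the
height `b`, `q ↦ D^m_p [K(q)[F(p - q), G(p - q)]](p)` is continuous on the half-space `q.1 > 0`,
hence a.e. strongly measurable on the slab `(0, b) × E`. [folklore] -/
theorem aestronglyMeasurable_iteratedFDeriv_oseenKernel_convIntegrand (hbT : b ≤ T')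
    (hF : ContDiffOn ℝ ∞ F (Iio T' ×ˢ univ)) (hG : ContDiffOn ℝ ∞ G (Iio T' ×ˢ univ)) (m : ℕ)
    {p : ℝ × E} (hp : p ∈ Iio b ×ˢ (univ : Set E)) :
    AEStronglyMeasurable (fun q : ℝ × E => iteratedFDeriv ℝ m
        (fun p' : ℝ × E => oseenKernelCLM q.1 q.2 (F (p' - q)) (G (p' - q))) p)
      ((volume : Measure (ℝ × E)).restrict (Ioo 0 b ×ˢ univ)) := by
  have hW : IsOpen ((Iio b ×ˢ (univ : Set E)) ×ˢ (Ioi (0 : ℝ) ×ˢ (univ : Set E))) :=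
    (isOpen_Iio.prod isOpen_univ).prod (isOpen_Ioi.prod isOpen_univ)
  have hc := continuousOn_iteratedFDeriv_section_left hW
    (contDiffOn_oseenKernel_convIntegrand_prod hbT hF hG) m
  have hc' : ContinuousOn (fun q : ℝ × E => iteratedFDeriv ℝ m
      (fun p' : ℝ × E => oseenKernelCLM q.1 q.2 (F (p' - q)) (G (p' - q))) p)
      (Ioi (0 : ℝ) ×ˢ (univ : Set E)) :=
    hc.comp (f := fun q : ℝ × E => (p, q)) (continuousOn_const.prodMk continuousOn_id)
      fun q hq => mk_mem_prod hp hq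
  have hS : MeasurableSet (Ioo (0 : ℝ) b ×ˢ (univ : Set E)) := measurableSet_Ioo.prod MeasurableSet.univ
  exact (hc'.mono (prod_mono Ioo_subset_Ioi_self subset_rfl)).aestronglyMeasurable hS

omit [FiniteDimensional ℝ E] [MeasurableSpace E] [BorelSpace E] in
/-- **The Leibniz bound for the near integrand**: for `p` below the height `b ≤ T'` and
`q.1 > 0`,
`‖D^m_p [K(q)[F(p-q), G(p-q)]](p)‖ ≤ ‖K(q)‖ Σ_{i ≤ m} (m choose i) ‖D^i F(p-q)‖ ‖D^{m-i} G(p-q)‖`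
(`ContinuousLinearMap.norm_iteratedFDerivWithin_le_of_bilinear` on the open set `{θ < b} × E`,
and `D^i [F(· - q)] = (D^i F)(· - q)`). [folklore] -/
theorem norm_iteratedFDeriv_oseenKernel_convIntegrand_le (hbT : b ≤ T')
    (hF : ContDiffOn ℝ ∞ F (Iio T' ×ˢ univ)) (hG : ContDiffOn ℝ ∞ G (Iio T' ×ˢ univ)) (m : ℕ)
    {p q : ℝ × E} (hp : p ∈ Iio b ×ˢ (univ : Set E)) (hq : q ∈ Ioi (0 : ℝ) ×ˢ (univ : Set E)) :
    ‖iteratedFDeriv ℝ m (fun p' : ℝ × E => oseenKernelCLM q.1 q.2 (F (p' - q)) (G (p' - q))) p‖ ≤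
      ‖oseenKernelCLM q.1 q.2‖ * ∑ i ∈ Finset.range (m + 1),
        (m.choose i : ℝ) * ‖iteratedFDeriv ℝ i F (p - q)‖ * ‖iteratedFDeriv ℝ (m - i) G (p - q)‖ := by
  set U : Set (ℝ × E) := Iio b ×ˢ univ with hU_def
  have hU : IsOpen U := isOpen_Iio.prod isOpen_univ
  have hmaps : MapsTo (fun p' : ℝ × E => p' - q) U (Iio T' ×ˢ univ) := fun p' hp' =>
    sub_mem_Iio_prod_of_mem hbT hp' hq
  have hF' : ContDiffOn ℝ ∞ (fun p' : ℝ × E => F (p' - q)) U :=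
    hF.comp (f := fun p' : ℝ × E => p' - q) (contDiffOn_id.sub contDiffOn_const) hmaps
  have hG' : ContDiffOn ℝ ∞ (fun p' : ℝ × E => G (p' - q)) U :=
    hG.comp (f := fun p' : ℝ × E => p' - q) (contDiffOn_id.sub contDiffOn_const) hmaps
  have h := (oseenKernelCLM q.1 q.2).norm_iteratedFDerivWithin_le_of_bilinear hF' hG' hU.uniqueDiffOn
    hp (n := m) (by exact_mod_cast le_top)
  rw [iteratedFDerivWithin_of_isOpen m hU hp] at h
  refine h.trans (le_of_eq ?_)
  congr 1
  refine Finset.sum_congr rfl fun i _ => ?_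
  rw [iteratedFDerivWithin_of_isOpen i hU hp, iteratedFDerivWithin_of_isOpen (m - i) hU hp,
    iteratedFDeriv_comp_sub, iteratedFDeriv_comp_sub]

omit [InnerProductSpace ℝ E] [FiniteDimensional ℝ E] [MeasurableSpace E] [BorelSpace E] in
/-- The binomial sum against constant factors: `Σ_{i ≤ m} (m choose i) a c = 2^m a c`. [folklore] -/
theorem sum_range_choose_mul_const (m : ℕ) (a c : ℝ) :
    ∑ i ∈ Finset.range (m + 1), (m.choose i : ℝ) * a * c = 2 ^ m * a * c := by
  rw [← Finset.sum_mul, ← Finset.sum_mul]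
  congr 2
  have h := Nat.sum_range_choose m
  exact_mod_cast h

omit [FiniteDimensional ℝ E] [MeasurableSpace E] [BorelSpace E] in
/-- **Uniform bound for the near integrand's derivatives**: if the derivatives of orders `≤ m`
of `F`, `G` are bounded by `C_F ≥ 0`, `C_G` below the height `θ₀`, then for `p` below the
heights `b` and `θ₀` and `q.1 > 0`, `‖D^m_p [K(q)[F(p-q), G(p-q)]](p)‖ ≤ ‖K(q)‖ 2^m C_F C_G` (the
translates `p - q` lie below the height `θ₀`). [folklore] -/
theorem norm_iteratedFDeriv_oseenKernel_convIntegrand_le_const (hbT : b ≤ T')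
    (hF : ContDiffOn ℝ ∞ F (Iio T' ×ˢ univ)) (hG : ContDiffOn ℝ ∞ G (Iio T' ×ˢ univ)) (m : ℕ)
    {θ₀ CF CG : ℝ} (hCF : 0 ≤ CF)
    (hFb : ∀ i ≤ m, ∀ r : ℝ × E, r.1 < θ₀ → ‖iteratedFDeriv ℝ i F r‖ ≤ CF)
    (hGb : ∀ i ≤ m, ∀ r : ℝ × E, r.1 < θ₀ → ‖iteratedFDeriv ℝ i G r‖ ≤ CG)
    {p q : ℝ × E} (hp : p ∈ Iio b ×ˢ (univ : Set E)) (hpθ : p.1 ≤ θ₀)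
    (hq : q ∈ Ioi (0 : ℝ) ×ˢ (univ : Set E)) :
    ‖iteratedFDeriv ℝ m (fun p' : ℝ × E => oseenKernelCLM q.1 q.2 (F (p' - q)) (G (p' - q))) p‖ ≤
      ‖oseenKernelCLM q.1 q.2‖ * (2 ^ m * CF * CG) := by
  refine (norm_iteratedFDeriv_oseenKernel_convIntegrand_le hbT hF hG m hp hq).trans ?_
  refine mul_le_mul_of_nonneg_left ?_ (ContinuousLinearMap.opNorm_nonneg (oseenKernelCLM q.1 q.2))
  rw [← sum_range_choose_mul_const]
  refine Finset.sum_le_sum fun i hi => ?_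
  have him : i ≤ m := Nat.lt_succ_iff.1 (Finset.mem_range.1 hi)
  have hr : (p - q).1 < θ₀ := by
    have h2 : 0 < q.1 := (mem_prod.1 hq).1
    show p.1 - q.1 < θ₀
    linarith
  have h1 := hFb i him (p - q) hr
  have h2 := hGb (m - i) (Nat.sub_le m i) (p - q) hr
  have h0 : (0 : ℝ) ≤ (m.choose i : ℝ) := by positivity
  exact mul_le_mul (mul_le_mul_of_nonneg_left h1 h0) h2 (norm_nonneg _) (mul_nonneg h0 hCF)

end Integrand

/-! ### The near part: smoothness and derivative bounds -/

section Near

variable {E : Type*} [NormedAddCommGroup E] [InnerProductSpace ℝ E] [FiniteDimensional ℝ E]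
  [MeasurableSpace E] [BorelSpace E]

variable {T' b : ℝ} {F G : ℝ × E → E}

omit [NormedAddCommGroup E] [InnerProductSpace ℝ E] [FiniteDimensional ℝ E] [MeasurableSpace E]
  [BorelSpace E] in
/-- From bounds of every single order to a common bound of all orders `≤ m`. [folklore] -/
theorem exists_forall_le_norm_iteratedFDeriv_le {X : Type*} [NormedAddCommGroup X] [NormedSpace ℝ X]
    {Y : Type*} [NormedAddCommGroup Y] [NormedSpace ℝ Y] {H : X → Y} {P : X → Prop}
    (hH : ∀ i : ℕ, ∃ C : ℝ, ∀ r : X, P r → ‖iteratedFDeriv ℝ i H r‖ ≤ C) (m : ℕ) :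
    ∃ C : ℝ, 0 ≤ C ∧ ∀ i ≤ m, ∀ r : X, P r → ‖iteratedFDeriv ℝ i H r‖ ≤ C := by
  induction m with
  | zero =>
    obtain ⟨C, hC⟩ := hH 0
    refine ⟨max C 0, le_max_right _ _, fun i hi r hr => ?_⟩
    rw [Nat.le_zero.1 hi]
    exact (hC r hr).trans (le_max_left _ _)
  | succ m ih =>
    obtain ⟨C, hC0, hC⟩ := ih
    obtain ⟨C', hC'⟩ := hH (m + 1)
    refine ⟨max C C', le_max_of_le_left hC0, fun i hi r hr => ?_⟩
    rcases Nat.of_le_succ hi with hle | heq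
    · exact (hC i hle r hr).trans (le_max_left _ _)
    · rw [heq]
      exact (hC' r hr).trans (le_max_right _ _)

/-- **Hypotheses of the dominated smooth-dependence theorem for the near part.** For `F`, `G`
jointly `C^∞` below the height `T'` with bounded derivatives of every order there, and
`0 < b ≤ T'`: (i) for every `q` in the slab `(0, b) × E` the integrand
`p ↦ K(q)[F(p-q), G(p-q)]` is `C^∞` on `{θ < b} × E`; (ii) its parameter derivatives are
measurable in `q`; (iii) near every `p₀` they are dominated by `C (s + ‖z‖²)^{-(d+1)/2} 2^m C_F C_G`,
integrable on the slab. [folklore] -/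
theorem oseenKernel_conv_dominated_hypotheses (hb : 0 < b) (hbT : b ≤ T')
    (hF : ContDiffOn ℝ ∞ F (Iio T' ×ˢ univ)) (hG : ContDiffOn ℝ ∞ G (Iio T' ×ˢ univ))
    (hFb : ∀ i : ℕ, ∃ C : ℝ, ∀ r : ℝ × E, r.1 < T' → ‖iteratedFDeriv ℝ i F r‖ ≤ C)
    (hGb : ∀ i : ℕ, ∃ C : ℝ, ∀ r : ℝ × E, r.1 < T' → ‖iteratedFDeriv ℝ i G r‖ ≤ C) :
    (∀ᵐ q ∂((volume : Measure (ℝ × E)).restrict (Ioo 0 b ×ˢ univ)),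
        ContDiffOn ℝ ∞ (fun p : ℝ × E =>
          oseenKernelCLM q.1 q.2 (F (p - q)) (G (p - q))) (Iio b ×ˢ univ)) ∧
    (∀ m : ℕ, ∀ p ∈ Iio b ×ˢ (univ : Set E), AEStronglyMeasurable
        (fun q : ℝ × E => iteratedFDeriv ℝ m (fun p' : ℝ × E =>
          oseenKernelCLM q.1 q.2 (F (p' - q)) (G (p' - q))) p)
        ((volume : Measure (ℝ × E)).restrict (Ioo 0 b ×ˢ univ))) ∧
    (∀ m : ℕ, ∀ p₀ ∈ Iio b ×ˢ (univ : Set E), ∃ ε > 0, ∃ g : ℝ × E → ℝ,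
        Integrable g ((volume : Measure (ℝ × E)).restrict (Ioo 0 b ×ˢ univ)) ∧
        ∀ᵐ q ∂((volume : Measure (ℝ × E)).restrict (Ioo 0 b ×ˢ univ)), ∀ p ∈ ball p₀ ε,
          ‖iteratedFDeriv ℝ m (fun p' : ℝ × E =>
            oseenKernelCLM q.1 q.2 (F (p' - q)) (G (p' - q))) p‖ ≤ g q) := by
  set S : Set (ℝ × E) := Ioo 0 b ×ˢ univ with hS_def
  have hS : MeasurableSet S := measurableSet_Ioo.prod MeasurableSet.univ
  have hae : ∀ᵐ q ∂((volume : Measure (ℝ × E)).restrict S), q ∈ S := ae_restrict_mem hS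
  have hSsub : S ⊆ Ioi (0 : ℝ) ×ˢ (univ : Set E) := prod_mono Ioo_subset_Ioi_self subset_rfl
  obtain ⟨CK, hCK, I, hI, hKw, hw⟩ := exists_integral_oseenEnvelope_slab_le (E := E)
  obtain ⟨hwint, -⟩ := hw hb
  refine ⟨?_, fun m p hp => aestronglyMeasurable_iteratedFDeriv_oseenKernel_convIntegrand hbT hF hG m hp, ?_⟩
  · filter_upwards [hae] with q hq
    exact contDiffOn_oseenKernel_convIntegrand hbT hF hG (hSsub hq)
  · intro m p₀ hp₀
    have hp₀1 : p₀.1 < b := (mem_prod.1 hp₀).1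
    obtain ⟨CF, hCF0, hCF⟩ := exists_forall_le_norm_iteratedFDeriv_le hFb m
    obtain ⟨CG, hCG0, hCG⟩ := exists_forall_le_norm_iteratedFDeriv_le hGb m
    refine ⟨b - p₀.1, sub_pos.2 hp₀1, fun q =>
      CK * (q.1 + ‖q.2‖ ^ 2) ^ (-(((Module.finrank ℝ E : ℝ) + 1) / 2)) * (2 ^ m * CF * CG),
      (hwint.const_mul CK).mul_const _, ?_⟩
    filter_upwards [hae] with q hq
    intro p hp
    have hq' : q ∈ Ioi (0 : ℝ) ×ˢ (univ : Set E) := hSsub hq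
    have hp' : p ∈ Iio b ×ˢ (univ : Set E) := by
      refine mk_mem_prod ?_ (mem_univ _)
      rw [mem_ball, Prod.dist_eq, max_lt_iff, Real.dist_eq] at hp
      have := (abs_lt.1 hp.1).2
      show p.1 < b
      linarith
    have hpT : p.1 ≤ T' := ((mem_prod.1 hp').1 : p.1 < b).le.trans hbT
    refine (norm_iteratedFDeriv_oseenKernel_convIntegrand_le_const hbT hF hG m hCF0 hCF hCG hp' hpT
      hq').trans ?_
    have h2 : 0 ≤ 2 ^ m * CF * CG := by positivity
    exact mul_le_mul_of_nonneg_right (hKw (mem_prod.1 hq').1 q.2) h2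

/-- **The near part is jointly `C^∞`**: for `F`, `G` jointly `C^∞` below the height `T'` with
bounded derivatives of every order there and `0 < b ≤ T'`,
`N(p) = ∫_{(0,b)×E} K(q)[F(p - q), G(p - q)] dq` is `C^∞` on `{θ < b} × E` (all derivatives fall
on the fields; KNSS 2009, Prop. 4.1, the near part of the estimate of `B` in the norms (4.5)).
[cite: KochNadirashviliSereginSverak2009, §4 Prop. 4.1 (arXiv:0709.3599 p. 8)] -/
theorem contDiffOn_oseenKernel_conv (hb : 0 < b) (hbT : b ≤ T')
    (hF : ContDiffOn ℝ ∞ F (Iio T' ×ˢ univ)) (hG : ContDiffOn ℝ ∞ G (Iio T' ×ˢ univ))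
    (hFb : ∀ i : ℕ, ∃ C : ℝ, ∀ r : ℝ × E, r.1 < T' → ‖iteratedFDeriv ℝ i F r‖ ≤ C)
    (hGb : ∀ i : ℕ, ∃ C : ℝ, ∀ r : ℝ × E, r.1 < T' → ‖iteratedFDeriv ℝ i G r‖ ≤ C) :
    ContDiffOn ℝ ∞ (fun p : ℝ × E => ∫ q in Ioo 0 b ×ˢ univ,
        oseenKernel q.1 q.2 (F (p - q)) (G (p - q)) ∂(volume : Measure (ℝ × E)))
      (Iio b ×ˢ univ) := by
  obtain ⟨hf, hmeas, hdom⟩ := oseenKernel_conv_dominated_hypotheses hb hbT hF hG hFb hGb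
  exact Literature.Analysis.FunctionSpaces.contDiffOn_integral_of_dominated
    (f := fun (p : ℝ × E) (q : ℝ × E) => oseenKernelCLM q.1 q.2 (F (p - q)) (G (p - q)))
    (isOpen_Iio.prod isOpen_univ) hf hmeas hdom

/-- **Derivative bound for the near part**: there is `C = C(E) > 0` such that for `F`, `G` as in
`contDiffOn_oseenKernel_conv`, `p = (θ, ξ)` with `θ < b`, and `C_F, C_G ≥ 0` bounding the
derivatives of orders `≤ m` of `F`, `G` below the height `θ`:
`‖D^m N(θ, ξ)‖ ≤ 2^m C_F C_G · C · 2√b` (Leibniz — the translates `F(p - q)`, `q.1 > 0`, live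
below the height `θ` — and the mass of the kernel's envelope on the slab). KNSS 2009, Prop. 4.1:
the weighted estimate of `B`, near part. [cite: KochNadirashviliSereginSverak2009, §4 (4.4)–(4.5) and Prop. 4.1 (arXiv:0709.3599 p. 8)] -/
theorem exists_norm_iteratedFDeriv_oseenKernel_conv_le :
    ∃ C : ℝ, 0 < C ∧ ∀ {T' b : ℝ} {F G : ℝ × E → E}, 0 < b → b ≤ T' →
      ContDiffOn ℝ ∞ F (Iio T' ×ˢ univ) → ContDiffOn ℝ ∞ G (Iio T' ×ˢ univ) →
      (∀ i : ℕ, ∃ C : ℝ, ∀ r : ℝ × E, r.1 < T' → ‖iteratedFDeriv ℝ i F r‖ ≤ C) →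
      (∀ i : ℕ, ∃ C : ℝ, ∀ r : ℝ × E, r.1 < T' → ‖iteratedFDeriv ℝ i G r‖ ≤ C) →
      ∀ (m : ℕ) {p : ℝ × E}, p ∈ Iio b ×ˢ (univ : Set E) → ∀ {CF CG : ℝ}, 0 ≤ CF → 0 ≤ CG →
      (∀ i ≤ m, ∀ r : ℝ × E, r.1 < p.1 → ‖iteratedFDeriv ℝ i F r‖ ≤ CF) →
      (∀ i ≤ m, ∀ r : ℝ × E, r.1 < p.1 → ‖iteratedFDeriv ℝ i G r‖ ≤ CG) →
        ‖iteratedFDeriv ℝ m (fun p' : ℝ × E => ∫ q in Ioo 0 b ×ˢ univ,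
            oseenKernel q.1 q.2 (F (p' - q)) (G (p' - q)) ∂(volume : Measure (ℝ × E))) p‖ ≤
          2 ^ m * CF * CG * (C * (2 * Real.sqrt b)) := by
  obtain ⟨CK, hCK, I, hI, hKw, hw⟩ := exists_integral_oseenEnvelope_slab_le (E := E)
  refine ⟨CK * I, mul_pos hCK hI, ?_⟩
  intro T' b F G hb hbT hF hG hFb hGb m p hp CF CG hCF hCG hFp hGp
  obtain ⟨hwint, hwle⟩ := hw hb
  obtain ⟨hf, hmeas, hdom⟩ := oseenKernel_conv_dominated_hypotheses hb hbT hF hG hFb hGb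
  set S : Set (ℝ × E) := Ioo 0 b ×ˢ univ with hS_def
  have hS : MeasurableSet S := measurableSet_Ioo.prod MeasurableSet.univ
  have hSsub : S ⊆ Ioi (0 : ℝ) ×ˢ (univ : Set E) := prod_mono Ioo_subset_Ioi_self subset_rfl
  set w : ℝ × E → ℝ := fun q => (q.1 + ‖q.2‖ ^ 2) ^ (-(((Module.finrank ℝ E : ℝ) + 1) / 2)) with hw_def
  have hle : ∀ᵐ q ∂((volume : Measure (ℝ × E)).restrict S),
      ‖iteratedFDeriv ℝ m (fun p' : ℝ × E => oseenKernelCLM q.1 q.2 (F (p' - q)) (G (p' - q))) p‖ ≤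
        CK * w q * (2 ^ m * CF * CG) := by
    filter_upwards [ae_restrict_mem hS] with q hq
    have hq' : q ∈ Ioi (0 : ℝ) ×ˢ (univ : Set E) := hSsub hq
    refine (norm_iteratedFDeriv_oseenKernel_convIntegrand_le_const hbT hF hG m hCF hFp hGp hp le_rfl
      hq').trans ?_
    have h2 : 0 ≤ 2 ^ m * CF * CG := by positivity
    exact mul_le_mul_of_nonneg_right (hKw (mem_prod.1 hq').1 q.2) h2
  have h := Literature.Analysis.FunctionSpaces.norm_iteratedFDeriv_integral_le_of_le
    (f := fun (p : ℝ × E) (q : ℝ × E) => oseenKernelCLM q.1 q.2 (F (p - q)) (G (p - q)))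
    (isOpen_Iio.prod isOpen_univ) hf hmeas hdom m hp ((hwint.const_mul CK).mul_const _) hle
  refine h.trans ?_
  rw [integral_mul_const, integral_const_mul]
  have h2 : 0 ≤ 2 ^ m * CF * CG := by positivity
  calc CK * (∫ q in S, w q ∂(volume : Measure (ℝ × E))) * (2 ^ m * CF * CG)
      ≤ CK * (I * (2 * Real.sqrt b)) * (2 ^ m * CF * CG) :=
        mul_le_mul_of_nonneg_right (mul_le_mul_of_nonneg_left hwle hCK.le) h2
    _ = 2 ^ m * CF * CG * (CK * I * (2 * Real.sqrt b)) := by ring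

end Near

end Literature.Analysis.FluidPDE

end
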